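import Literature.IUT.LogVolume.GenuineLogThetaPerImageExactVolume
import Literature.IUT.LogVolume.TensorPacketContentSharp
import Literature.IUT.LogVolume.TensorPacketLogStar
import Literature.IUT.LogVolume.TensorPacketOrbitSpan
import Literature.IUT.LogVolume.PacketBases
import Literature.IUT.LogVolume.LocalFieldTraceRetraction
import HarnessLib

/-!
# The EXACT content of the Θ-region `ι_j(t)·(R_I)^∼` at a TAME tuple, and the exact per-image number `−|log(Θ)|^{(P)}_p`
# at (possibly RAMIFIED) tame primes: `hull(slot images) = packetHull(p^{A}·log_p(R_I^×))`, `A = (ord t − 1) div e_j + 1 − (j+1)`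
# ([IUTchIV] Prop. 1.1, Prop. 1.2 (ii); [IUTchIII] Cor. 3.12 Step (x); Dupuy–Hilado §4.9, §4.12)

Proof-only file of the abc-iut cell (Cor. 3.12 sub-crew, seat abc-iut-c312-1 = holder of record of the typed [IUTchIII] Thm. 3.11, gen 16; row
«R22 = C:SLOT-HULL-UNCONDITIONAL», C LEAD ruling C-R135 (b)).  CONTAINER statements only (no `JannsenWingbergMappingClass`, no sub-indeterminacy,
no strip moves): classical local algebra about the Dupuy–Hilado / [IUTchIV] §1 objects of the tree; TAKES NO SIDE on [IUTchIII] Cor. 3.12.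

Setting: a tensor packet `V = ⊗_{ℚ_p, i} k_i` of `p`-adic fields (the cell's MLF class), `R_I = ⊗_{ℤ_p} 𝒪_{k_i}` (`integerPacket`), `(R_I)^∼` its
normalisation (`normalizedPacket`), `L = log_p(R_I^×) = ⊗ log_p(𝒪_i^×)` (`logPacket`); at a TAME tuple (`p > 2`, every `e_i ≤ p − 2`) `log_p(𝒪_i^×) = 𝔪_i`.

* §1 `TameContent.inv_prime_smul_purePacket_not_mem_integerPacket` — a pure tensor `⊗ y_i` with every `y_i ∈ 𝒪_i ∖ p𝒪_i` is PRIMITIVE in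
  `R_I`: `p⁻¹·⊗ y_i ∉ R_I` (in integral bases — abc-iut-S5 `exists_integralBasis` — each `y_i` has a unit coordinate, so `p⁻¹·⊗ y_i` has a
  tensor-basis coordinate of norm `p`, against abc-iut-E-t58's `norm_repr_le_of_mem_integerPacket`); `TameContent.eq_purePacket_mul_of_mem_logPacket`
  — at a tame tuple `L = (⊗ ϖ_i)·R_I` elementwise (w6-d018 `exists_mem_integerPacket_of_mem_logPacket_of_dominates`);
* §2 **`TameContent.iota_not_mem_zpow_smul_logPacket`** — for `‖g‖ = p^{−v/e_{i₀}}`: `ι_{i₀}(g) ∉ p^{A+1}·L`, `A = (v − 1) div e_{i₀} + 1 − |I|`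
  (`p^{−A−1}·(⊗ϖ_i)⁻¹·ι_{i₀}(g) = p⁻¹·⊗ y_i` with `y_i = p·ϖ_i⁻¹` (`i ≠ i₀`), `y_{i₀} = p^{−(v−1) div e}·ϖ⁻¹·g`, all in `𝒪 ∖ p𝒪`); with abc-iut-w4-d006's
  STAR FORM of [IUTchIV] Prop. 1.2 (ii) (`iota_smul_normalizedPacket_subset_zpow_smul_logPacket_of_star` + `floor_star_of_tame'`:
  `ι_{i₀}(g)·(R_I)^∼ ⊆ p^{A}·L`) this is the CONTENT PAIR **`TameContent.content_iota_smul_normalizedPacket`**, hence by abc-iut-w5-d180's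
  `packetHull_orbit_eq_zpow` **`TameContent.packetHull_orbit_iota_smul_normalizedPacket_eq`**: the `(R_I)^∼`-hull of the (Ind2)-orbit
  `⋃_{γ ∈ indTwo} γ·(ι_{i₀}(g)·(R_I)^∼)` IS `packetHull(p^{A}·L)` — UNCONDITIONALLY, for every integral structure (`(R_I)^∼ = R_I` or not);
* §3 the real prime packet `realPrimePacketWith p 𝔽 c` over ANY local-field family (abc-iut-c312-3; in particular the GENUINE completions of a
  place section): **`realPrimePacketWith_slotImagesHull_pilotRegion_eq_of_tame`** (`hull(slot images of O_𝕃(−P_Θ)_{v⃗}) = packetHull(p^{A}·L)`,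
  `A = (v − 1) div e(v̲_j) + 1 − (j+1)` for `‖t_{i,v_j}‖ = p^{−v/e(v̲_j)}`) and **`realPrimePacketWith_negLogThetaPerImageAt_eq_of_tame`** — the
  EXACT value `−|log(Θ)|^{(P)}_p = (1/ℓ⋆)·Σ_i Σ_{v⃗} (−A(i,v⃗)·log p + log μ̄(hull(log_p(R_{v⃗}^×))))·Π_b Pr(v_b)` at a prime over which every
  field of the family is TAME (abc-iut-s2-p2's `realPrimePacketWith_negLogThetaPerImageAt_eq_of_content` fed with the content pair).
WHAT IS (NOT) NEEDED: only `p > 2` and tameness `e ≤ p − 2` of every factor; NONE of the seat's R21 binders `h3` (local degree ≥ 3), `hodd`, `hf`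
(residue degree ≠ 1), `hMC`, `H` — those concern print's (Ind1) strip part reaching the container, not the container itself (R21
`Summits/ABC/IUTFork/Thm311RealInd1StripPacketThetaJunction{,Volume}` obtained the same value only through that conditional chain).  Residues:
`p = 2`, WILD factors.  HONEST SCOPE: (Ind2) = the tree's container `indTwo`, the hull = abc-iut-S2's `(R_I)^∼`-span, reading (P) = the cell's
`negLogThetaPerImageAt`; nothing here bears on which reading or which indeterminacy group print means; typed ≠ proved; no side taken; NO abc claim.
[cite: Mochizuki2012, IUTchIV Prop. 1.1 p. 9, Prop. 1.2 (ii) p. 10–11] [cite: Mochizuki2012, IUTchIII Cor. 3.12 proof Step (x) p. 181]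
[cite: DupuyHilado2025, §4.9, §4.12] [cite: WeilBNT1967, Ch. II §2, Th. 1] [claim: Mochizuki2012, status: disputed] for every IUT quotation.
PROOF-ONLY: no definitions, no `Prop` facts.
-/

set_option autoImplicit false

noncomputable section

open Set Module Function NumberField IsDedekindDomain
open scoped Pointwise TensorProduct NormedField

namespace Literature.IUT.LogVolume

namespace TameContent

section Packet

variable (p : ℕ) [hp : Fact p.Prime]
variable {I : Type} [Fintype I] [DecidableEq I] [Nonempty I]
variable (k : I → Type) [∀ i, NontriviallyNormedField (k i)] [∀ i, NormedAlgebra ℚ_[p] (k i)]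
  [∀ i, IsUltrametricDist (k i)] [∀ i, ProperSpace (k i)]

/-! ## §1 Primitive pure tensors; `L = (⊗ϖ_i)·R_I` at a tame tuple -/

omit [Fintype I] [DecidableEq I] [Nonempty I] [∀ i, ProperSpace (k i)] in
/-- An integer `y ∈ 𝒪 ∖ p𝒪` of a `p`-adic field has a UNIT coordinate in any integral basis (else all coordinates lie in `pℤ_p` and
`‖y‖ ≤ p⁻¹`). [cite: WeilBNT1967, Ch. II §2, Th. 1] -/
theorem exists_norm_repr_eq_one (i : I) {κ : Type} [Fintype κ] (bZ : Basis κ ℤ_[p] (Valued.integer (k i)))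
    (bQ : Basis κ ℚ_[p] (k i)) (hb : ∀ j, bQ j = (bZ j : k i)) {y : k i} (hy1 : ‖y‖ ≤ 1) (hyp : (p : ℝ)⁻¹ < ‖y‖) :
    ∃ j, ‖bQ.repr y j‖ = 1 := by
  by_contra hcon
  push Not at hcon
  -- every coordinate has norm `≤ p⁻¹`
  have hsmall : ∀ j, ‖bQ.repr y j‖ ≤ (p : ℝ)⁻¹ := by
    intro j
    have hle : ‖bQ.repr y j‖ ≤ 1 := norm_repr_le_one bZ bQ hb hy1 j
    have hlt : ‖bQ.repr y j‖ < 1 := lt_of_le_of_ne hle (hcon j)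
    rw [repr_eq_of_norm_le_one bZ bQ hb hy1 j] at hlt ⊢
    set z : ℤ_[p] := bZ.repr ⟨y, Valued.integer.mem_iff.mpr hy1⟩ j
    rw [PadicInt.padic_norm_e_of_padicInt] at hlt ⊢
    obtain ⟨w, hw⟩ := (PadicInt.norm_lt_one_iff_dvd z).mp hlt
    rw [hw, norm_mul, PadicInt.norm_p]
    exact mul_le_of_le_one_right (by positivity) (PadicInt.norm_le_one w)
  -- hence `‖y‖ ≤ p⁻¹`
  have hy : ‖y‖ ≤ (p : ℝ)⁻¹ := by
    conv_lhs => rw [← bQ.sum_repr y]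
    refine IsUltrametricDist.norm_sum_le_of_forall_le_of_nonneg (by positivity) fun j _ => ?_
    rw [norm_smul]
    calc ‖bQ.repr y j‖ * ‖bQ j‖ ≤ (p : ℝ)⁻¹ * 1 :=
          mul_le_mul (hsmall j) (norm_basis_le_one bZ bQ hb j) (norm_nonneg _) (by positivity)
      _ = (p : ℝ)⁻¹ := mul_one _
  exact absurd hyp (not_lt.mpr hy)

omit [DecidableEq I] [Nonempty I] in
/-- **A pure tensor of integers off `p𝒪` is PRIMITIVE in `R_I`**: if every `y_i ∈ 𝒪_i` has `‖y_i‖ > p⁻¹` then `p⁻¹·⊗ y_i ∉ R_I` — in the tensor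
basis of integral bases the coordinate of `⊗ y_i` at a tuple of unit coordinates is a unit, so that of `p⁻¹·⊗ y_i` has norm `p > 1`
(abc-iut-E-t58's `norm_repr_le_of_mem_integerPacket`). [cite: Mochizuki2012, IUTchIV Prop. 1.1 p. 9] [cite: WeilBNT1967, Ch. II §2, Th. 1] -/
theorem inv_prime_smul_purePacket_not_mem_integerPacket {y : Π i, k i} (hy1 : ∀ i, ‖y i‖ ≤ 1)
    (hyp : ∀ i, (p : ℝ)⁻¹ < ‖y i‖) :
    (p : ℚ_[p])⁻¹ • purePacket p k y ∉ integerPacket p k := by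
  classical
  -- integral bases in every factor
  have hB := fun i => exists_integralBasis (p := p) (k i)
  choose n bZ bQ hb using hB
  -- a unit coordinate in every factor
  have hJ := fun i => exists_norm_repr_eq_one p k i (bZ i) (bQ i) (hb i) (hy1 i) (hyp i)
  choose J hJ1 using hJ
  intro hmem
  have hle := norm_repr_le_of_mem_integerPacket bZ bQ hb hmem J
  rw [map_smul, Finsupp.smul_apply, purePacket, Basis.piTensorProduct_repr_tprod_apply, smul_eq_mul, norm_mul, norm_inv,
    Padic.norm_p, inv_inv, norm_prod, Finset.prod_eq_one (fun i _ => hJ1 i), mul_one] at hle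
  have hp1 : (1 : ℝ) < p := by exact_mod_cast hp.out.one_lt
  exact absurd hle (not_le.mpr hp1)

omit [Fintype I] [DecidableEq I] [Nonempty I] in
/-- **At a TAME tuple `log_p(R_I^×) = (⊗ ϖ_i)·R_I` elementwise**: every `w ∈ L` is `(⊗ ϖ_i)·a` with `a ∈ R_I`, for any uniformizers `ϖ_i`
(`‖ϖ_i‖ = p^{−1/e_i}` dominates `log_p(𝒪_i^×) = 𝔪_i`). [cite: Mochizuki2012, IUTchIV Prop. 1.2 (i) p. 10] -/
theorem eq_purePacket_mul_of_mem_logPacket (hp2 : 2 < p) (he : ∀ i, absRamificationIdx p (k i) ≤ p - 2)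
    {ϖ : Π i, k i} (hϖ : ∀ i, ‖ϖ i‖ = (p : ℝ) ^ (-(1 / (absRamificationIdx p (k i) : ℝ))))
    {w : PacketAlgebra p k} (hw : w ∈ logPacket p k) :
    ∃ a ∈ integerPacket p k, w = purePacket p k ϖ * a := by
  have hϖ0 : ∀ i, ϖ i ≠ 0 := fun i => norm_pos_iff.mp (by rw [hϖ i]; positivity)
  refine exists_mem_integerPacket_of_mem_logPacket_of_dominates p k hϖ0 (fun i z hz => ?_) hw
  rw [hϖ i]
  exact norm_le_rpow_of_norm_lt_one p (k i) ((mem_logUnits_iff_norm_lt_one_of_tame p hp2 (he i) z).mp hz)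

/-! ## §2 The content of the twist `ι_{i₀}(g)·(R_I)^∼` at a tame tuple -/

/-- **`ι_{i₀}(g) ∉ p^{A+1}·log_p(R_I^×)`** at a TAME tuple, for `‖g‖ = p^{−v/e_{i₀}}` and `A = (v − 1) div e_{i₀} + 1 − |I|`: otherwise
`p^{−A−1}·(⊗ϖ_i)⁻¹·ι_{i₀}(g) = p⁻¹·⊗ y_i` would lie in `R_I`, with `y_i = p·ϖ_i⁻¹` (`i ≠ i₀`) and `y_{i₀} = p^{−(v−1) div e}·ϖ⁻¹·g` all in `𝒪 ∖ p𝒪`.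
[cite: Mochizuki2012, IUTchIV Prop. 1.1 p. 9, Prop. 1.2 (ii) p. 10–11] -/
theorem iota_not_mem_zpow_smul_logPacket (hp2 : 2 < p) (he : ∀ i, absRamificationIdx p (k i) ≤ p - 2) (i₀ : I) {g : k i₀} {v : ℤ}
    (hg : ‖g‖ = (p : ℝ) ^ (-(v / (absRamificationIdx p (k i₀) : ℝ)))) :
    iota p k i₀ g ∉ ((p : ℚ_[p]) ^ ((v - 1) / (absRamificationIdx p (k i₀) : ℤ) + 1 - Fintype.card I + 1)) •
      (logPacket p k : Set (PacketAlgebra p k)) := by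
  classical
  -- uniformizers
  have hϖ := fun i => exists_norm_eq_rpow_neg p (k i) 1
  choose ϖu hϖu using hϖ
  let ϖ : Π i, k i := fun i => (ϖu i : k i)
  have hϖ : ∀ i, ‖ϖ i‖ = (p : ℝ) ^ (-(1 / (absRamificationIdx p (k i) : ℝ))) := fun i => by
    have := hϖu i; push_cast at this; exact this
  have hϖ0 : ∀ i, ϖ i ≠ 0 := fun i => (ϖu i).ne_zero
  -- numerics
  set E : ℕ := absRamificationIdx p (k i₀) with hE
  set a : ℤ := (v - 1) / (E : ℤ) with ha
  set r : ℤ := (v - 1) % (E : ℤ) with hr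
  have hP : p.Prime := hp.out
  have hp0 : (0 : ℝ) < p := by exact_mod_cast hP.pos
  have hp1 : (1 : ℝ) < p := by exact_mod_cast hP.one_lt
  have hpQ : (p : ℚ_[p]) ≠ 0 := by exact_mod_cast hP.ne_zero
  have hE0 : 0 < E := absRamificationIdx_pos p (k i₀)
  have hE0z : (0 : ℤ) < (E : ℤ) := by exact_mod_cast hE0
  have hE0r : (0 : ℝ) < (E : ℝ) := by exact_mod_cast hE0
  have hr0 : 0 ≤ r := Int.emod_nonneg _ hE0z.ne'
  have hrE : r < E := Int.emod_lt_of_pos _ hE0z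
  have hvar : (v : ℝ) - 1 = (E : ℝ) * a + r := by
    have h : v - 1 = (E : ℤ) * a + r := by rw [hr, Int.emod_def]; ring
    exact_mod_cast h
  intro hmem
  -- `ι(g) = p^{A+1} • (Π * b)`, `b ∈ R_I`
  obtain ⟨w, hw, hgw⟩ := Set.mem_smul_set.mp hmem
  obtain ⟨b, hb, rfl⟩ := eq_purePacket_mul_of_mem_logPacket p k hp2 he hϖ hw
  -- the scalars redistributing the powers of `p`
  let c : I → ℚ_[p] := fun i => if i = i₀ then (p : ℚ_[p]) ^ (-a) else (p : ℚ_[p])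
  let y : Π i, k i := fun i => c i • (ϖ i)⁻¹ * (Pi.mulSingle i₀ g : Π i, k i) i
  have hprod : ∏ i, c i = (p : ℚ_[p]) ^ ((Fintype.card I : ℤ) - 1 - a) := by
    rw [← Finset.mul_prod_erase Finset.univ c (Finset.mem_univ i₀)]
    have h1 : ∏ i ∈ Finset.univ.erase i₀, c i = (p : ℚ_[p]) ^ (Fintype.card I - 1) := by
      rw [Finset.prod_congr rfl (fun i hi => show c i = (p : ℚ_[p]) by simp only [c, if_neg (Finset.ne_of_mem_erase hi)]),
        Finset.prod_const, Finset.card_erase_of_mem (Finset.mem_univ _), Finset.card_univ]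
    rw [h1]
    simp only [c, if_pos rfl]
    rw [← zpow_natCast, ← zpow_add₀ hpQ, Nat.cast_sub (Fintype.card_pos (α := I))]
    congr 1
    push_cast
    ring
  -- `⊗ y = (∏ c) • (Π⁻¹ * ι(g))`
  have hy_eq : purePacket p k y = (∏ i, c i) • (purePacket p k ϖ⁻¹ * iota p k i₀ g) := by
    rw [iota_eq_purePacket, purePacket_mul, ← purePacket_smul]
    congr 1
    funext i
    simp only [y, Pi.inv_apply, Pi.mul_apply, smul_mul_assoc]
  -- `p⁻¹ • ⊗ y ∈ R_I`
  have hmemR : (p : ℚ_[p])⁻¹ • purePacket p k y ∈ integerPacket p k := by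
    have hPi : purePacket p k ϖ⁻¹ * (purePacket p k ϖ * b) = b := by
      rw [← mul_assoc, show purePacket p k ϖ⁻¹ * purePacket p k ϖ = 1 by
        rw [mul_comm]; exact purePacket_mul_inv p k hϖ0, one_mul]
    have h1 : purePacket p k ϖ⁻¹ * iota p k i₀ g =
        ((p : ℚ_[p]) ^ ((v - 1) / (E : ℤ) + 1 - Fintype.card I + 1)) • b := by
      rw [← hgw, mul_smul_comm, hPi]
    rw [hy_eq, h1, smul_smul, smul_smul, hprod, ← zpow_neg_one, ← zpow_add₀ hpQ, ← zpow_add₀ hpQ, ← ha]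
    have hexp : -1 + ((Fintype.card I : ℤ) - 1 - a) + (a + 1 - Fintype.card I + 1) = 0 := by ring
    rw [hexp, zpow_zero, one_smul]
    exact hb
  -- but `y_i ∈ 𝒪 ∖ p𝒪` in every factor: norms `p^{−r/e}` at `i₀`, `p⁻¹·p^{1/e_i}` elsewhere
  have hny₀ : ‖y i₀‖ = (p : ℝ) ^ (-((r : ℝ) / E)) := by
    rw [show y i₀ = ((p : ℚ_[p]) ^ (-a)) • (ϖ i₀)⁻¹ * g by simp [y, c]]
    rw [norm_mul, norm_smul, norm_inv, norm_zpow, Padic.norm_p, inv_zpow', neg_neg, hϖ, hg, ← Real.rpow_intCast,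
      ← Real.rpow_neg hp0.le, ← Real.rpow_add hp0, ← Real.rpow_add hp0]
    congr 1
    rw [show (absRamificationIdx p (k i₀) : ℝ) = E from rfl]
    field_simp
    linarith
  have hny : ∀ i, i ≠ i₀ → ‖y i‖ = (p : ℝ)⁻¹ * (p : ℝ) ^ (1 / (absRamificationIdx p (k i) : ℝ)) := by
    intro i hi
    simp only [y, c, if_neg hi, Pi.mulSingle_eq_of_ne hi, mul_one]
    rw [norm_smul, Padic.norm_p, norm_inv, hϖ, Real.rpow_neg hp0.le, inv_inv]
  refine inv_prime_smul_purePacket_not_mem_integerPacket p k (y := y) (fun i => ?_) (fun i => ?_) hmemR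
  · by_cases hi : i = i₀
    · subst hi
      rw [hny₀]
      refine Real.rpow_le_one_of_one_le_of_nonpos hp1.le ?_
      rw [neg_nonpos]
      exact div_nonneg (by exact_mod_cast hr0) hE0r.le
    · rw [hny i hi]
      have hEi : (0 : ℝ) < (absRamificationIdx p (k i) : ℝ) := by exact_mod_cast absRamificationIdx_pos p (k i)
      have h1 : (p : ℝ) ^ (1 / (absRamificationIdx p (k i) : ℝ)) ≤ (p : ℝ) ^ (1 : ℝ) :=
        Real.rpow_le_rpow_of_exponent_le hp1.le (by
          rw [div_le_one hEi]; exact_mod_cast absRamificationIdx_pos p (k i))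
      rw [Real.rpow_one] at h1
      calc (p : ℝ)⁻¹ * (p : ℝ) ^ (1 / (absRamificationIdx p (k i) : ℝ)) ≤ (p : ℝ)⁻¹ * p :=
            mul_le_mul_of_nonneg_left h1 (by positivity)
        _ = 1 := inv_mul_cancel₀ hp0.ne'
  · by_cases hi : i = i₀
    · subst hi
      rw [hny₀, ← Real.rpow_neg_one]
      refine Real.rpow_lt_rpow_of_exponent_lt hp1 ?_
      rw [neg_lt_neg_iff, div_lt_one hE0r]
      exact_mod_cast hrE
    · rw [hny i hi]
      have hEi : (0 : ℝ) < (absRamificationIdx p (k i) : ℝ) := by exact_mod_cast absRamificationIdx_pos p (k i)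
      have h1 : (1 : ℝ) < (p : ℝ) ^ (1 / (absRamificationIdx p (k i) : ℝ)) := Real.one_lt_rpow hp1 (by positivity)
      calc (p : ℝ)⁻¹ = (p : ℝ)⁻¹ * 1 := (mul_one _).symm
        _ < (p : ℝ)⁻¹ * (p : ℝ) ^ (1 / (absRamificationIdx p (k i) : ℝ)) := mul_lt_mul_of_pos_left h1 (by positivity)

/-- **THE CONTENT PAIR of the twist at a TAME tuple**: for `‖g‖ = p^{−v/e_{i₀}}` and `A = (v − 1) div e_{i₀} + 1 − |I|`,
`ι_{i₀}(g)·(R_I)^∼ ⊆ p^{A}·log_p(R_I^×)` ([IUTchIV] Prop. 1.2 (ii) in abc-iut-w4-d006's star form, `floor_star_of_tame'`) and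
`ι_{i₀}(g)·(R_I)^∼ ⊄ p^{A+1}·log_p(R_I^×)` (`ι_{i₀}(g) = ι_{i₀}(g)·1` is the witness) — the content of the twist w.r.t. `log_p(R_I^×)` IS `A`,
for EVERY integral structure. [cite: Mochizuki2012, IUTchIV Prop. 1.1 p. 9, Prop. 1.2 (ii) p. 10–11] [cite: DupuyHilado2025, §4.9] -/
theorem content_iota_smul_normalizedPacket (hp2 : 2 < p) (he : ∀ i, absRamificationIdx p (k i) ≤ p - 2) (i₀ : I) {g : k i₀} {v : ℤ}
    (hg : ‖g‖ = (p : ℝ) ^ (-(v / (absRamificationIdx p (k i₀) : ℝ)))) :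
    iota p k i₀ g • (normalizedPacket p k : Set (PacketAlgebra p k)) ⊆
        ((p : ℚ_[p]) ^ ((v - 1) / (absRamificationIdx p (k i₀) : ℤ) + 1 - Fintype.card I)) • (logPacket p k : Set (PacketAlgebra p k)) ∧
      ¬ iota p k i₀ g • (normalizedPacket p k : Set (PacketAlgebra p k)) ⊆
        ((p : ℚ_[p]) ^ ((v - 1) / (absRamificationIdx p (k i₀) : ℤ) + 1 - Fintype.card I + 1)) •
          (logPacket p k : Set (PacketAlgebra p k)) := by
  refine ⟨?_, fun h => iota_not_mem_zpow_smul_logPacket p k hp2 he i₀ hg (h ?_)⟩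
  · rw [← floor_star_of_tame' p k hp2 he i₀ v]
    exact iota_smul_normalizedPacket_subset_zpow_smul_logPacket_of_star p k i₀ i₀ hg
  · exact ⟨1, (normalizedPacket p k).one_mem, mul_one _⟩

/-- **THE `(R_I)^∼`-HULL OF THE CONTAINER ORBIT OF THE TWIST at a TAME tuple** (UNCONDITIONAL; no sub-indeterminacy, no hypothesis on degrees or
residue degrees): `packetHull(⋃_{γ ∈ indTwo} γ·(ι_{i₀}(g)·(R_I)^∼)) = packetHull(p^{A}·log_p(R_I^×))`, `A = (v − 1) div e_{i₀} + 1 − |I|`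
(abc-iut-w5-d180's orbit-content algebra `packetHull_orbit_eq_zpow` fed with the content pair).
[cite: Mochizuki2012, IUTchIV Prop. 1.2 (ii) p. 10–11] [cite: DupuyHilado2025, §4.9, §4.12] -/
theorem packetHull_orbit_iota_smul_normalizedPacket_eq (hp2 : 2 < p) (he : ∀ i, absRamificationIdx p (k i) ≤ p - 2) (i₀ : I)
    {g : k i₀} {v : ℤ} (hg : ‖g‖ = (p : ℝ) ^ (-(v / (absRamificationIdx p (k i₀) : ℝ)))) :
    packetHull p k (⋃ γ : indTwo p k, γ • (iota p k i₀ g • (normalizedPacket p k : Set (PacketAlgebra p k)))) =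
      packetHull p k (((p : ℚ_[p]) ^ ((v - 1) / (absRamificationIdx p (k i₀) : ℤ) + 1 - Fintype.card I)) •
        (logPacket p k : Set (PacketAlgebra p k))) := by
  obtain ⟨hsub, -⟩ := content_iota_smul_normalizedPacket p k hp2 he i₀ hg
  refine packetHull_orbit_eq_zpow p k (x := iota p k i₀ g) ⟨1, (normalizedPacket p k).one_mem, mul_one _⟩ ?_ hsub
  exact iota_not_mem_zpow_smul_logPacket p k hp2 he i₀ hg

end Packet

end TameContent

/-! ## §3 The real prime packet over a local-field family: the slot-image hull of `O_𝕃(−P_Θ)_{v⃗}` and `−|log(Θ)|^{(P)}_p`, exactly -/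

section RealPacketWith

variable {F : Type} [Field F] [NumberField F]
variable (p : ℕ) [hp : Fact p.Prime] (𝔽 : LocalFields F p)
variable (c : (j : ℕ) → (Fin (j + 1) → placesOver F p) → ℚ_[p]) (hc0 : ∀ j e, c j e ≠ 0)
  (hcσ : ∀ (j : ℕ) (σ : Equiv.Perm (Fin (j + 1))) (e : Fin (j + 1) → placesOver F p), c j (e ∘ σ) = c j e)

/-- **THE SLOT-IMAGE HULL OF THE Θ-REGION AT A TAME COLLECTION, EXACTLY (unconditional).**  Real prime packet over ANY local-field family
(any shell normalisation), Θ-idele `t`, degree `j = i+1`, collection `v⃗ = e` with every field `K_{v̲_b}` TAME (`p > 2`, `e(K_{v̲_b}) ≤ p − 2`); if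
`‖t_{i,v_j}‖ = p^{−v/e(K_{v̲_j})}` then the hull of the slot images of `O_𝕃(−P_Θ)_{v⃗} = ι_j(t_{i,v_j})·(R_I)^∼` — reading (P)'s region — IS
`packetHull(p^{A}·log_p(R_I^×))`, `A = (v − 1) div e(K_{v̲_j}) + 1 − (j+1)`.  No hypothesis on local degrees, residue degrees, parity, and no
Jannsen–Wingberg input (contrast the seat's R21, which reached this value through print's (Ind1) strip part modulo `JannsenWingbergMappingClass`).
[cite: Mochizuki2012, IUTchIII Cor. 3.12 proof Step (x) p. 181; IUTchIV Prop. 1.2 (ii) p. 10–11] [cite: DupuyHilado2025, §4.9, §4.12]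
[claim: Mochizuki2012, status: disputed] -/
theorem realPrimePacketWith_slotImagesHull_pilotRegion_eq_of_tame (hp2 : 2 < p) {lstar : ℕ}
    (t : Fin lstar → (v : placesOver F p) → (𝔽.k v)ˣ) (i : Fin lstar) (e : Fin ((i : ℕ) + 1 + 1) → placesOver F p)
    (he : ∀ b, absRamificationIdx p (𝔽.k (e b)) ≤ p - 2) {v : ℤ}
    (hv : ‖(t i (e (Fin.last _)) : 𝔽.k (e (Fin.last _)))‖ = (p : ℝ) ^ (-(v / (absRamificationIdx p (𝔽.k (e (Fin.last _))) : ℝ)))) :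
    (realPrimePacketWith p 𝔽 c hc0 hcσ).slotImagesHull ((realPrimePacketWith p 𝔽 c hc0 hcσ).pilotRegion t) ((i : ℕ) + 1) e =
      packetHull p (fun b => 𝔽.k (e b))
        (((p : ℚ_[p]) ^ ((v - 1) / (absRamificationIdx p (𝔽.k (e (Fin.last _))) : ℤ) + 1 - Fintype.card (Fin ((i : ℕ) + 1 + 1)))) •
          (logPacket p (fun b => 𝔽.k (e b)) : Set (PacketAlgebra p (fun b => 𝔽.k (e b))))) := by
  change packetHull p (fun b => 𝔽.k (e b)) ((realPrimePacketWith p 𝔽 c hc0 hcσ).slotImages _ _ e) = _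
  rw [realPrimePacketWith_slotImages_pilotRegion_eq]
  exact TameContent.packetHull_orbit_iota_smul_normalizedPacket_eq p (fun b => 𝔽.k (e b)) hp2 he (Fin.last _) hv

/-- **`−|log(Θ)|^{(P)}_p` AT A TAME PRIME, EXACTLY (unconditional).**  If every field `K_{v̲}`, `v ∣ p`, of the family is TAME and `v(i,v⃗) ∈ ℤ`
records the valuations `‖t_{i,v_j}‖ = p^{−v(i,v⃗)/e(K_{v̲_j})}` of the Θ-idele at the last slots, then
`−|log(Θ)|^{(P)}_p = (1/ℓ⋆)·Σ_i Σ_{v⃗} (−A(i,v⃗)·log p + log μ̄(hull(log_p(R_{v⃗}^×))))·Π_b Pr(v_b)`,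
`A(i,v⃗) = (v(i,v⃗) − 1) div e(K_{v̲_j}) + 1 − (j+1)` (abc-iut-s2-p2's `realPrimePacketWith_negLogThetaPerImageAt_eq_of_content` fed with the
content pair) — the per-image number of abc-iut-c312-d1's cells of record, now explicit at RAMIFIED tame primes too.
[cite: Mochizuki2012, IUTchIII Cor. 3.12 proof Step (x) p. 181] [cite: DupuyHilado2025, Def. 3.6.3, §4.12] [claim: Mochizuki2012, status: disputed] -/
theorem realPrimePacketWith_negLogThetaPerImageAt_eq_of_tame (hp2 : 2 < p) {lstar : ℕ}
    (t : Fin lstar → (v : placesOver F p) → (𝔽.k v)ˣ)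
    (he : ∀ w : placesOver F p, absRamificationIdx p (𝔽.k w) ≤ p - 2)
    (v : (i : Fin lstar) → (Fin ((i : ℕ) + 1 + 1) → placesOver F p) → ℤ)
    (hv : ∀ (i : Fin lstar) (e : Fin ((i : ℕ) + 1 + 1) → placesOver F p),
      ‖(t i (e (Fin.last _)) : 𝔽.k (e (Fin.last _)))‖ =
        (p : ℝ) ^ (-(v i e / (absRamificationIdx p (𝔽.k (e (Fin.last _))) : ℝ)))) :
    (realPrimePacketWith p 𝔽 c hc0 hcσ).negLogThetaPerImageAt lstar t =
      (1 / (lstar : ℝ)) * ∑ i : Fin lstar, ∑ e : Fin ((i : ℕ) + 1 + 1) → placesOver F p,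
        (-(((v i e - 1) / (absRamificationIdx p (𝔽.k (e (Fin.last _))) : ℤ) + 1 - Fintype.card (Fin ((i : ℕ) + 1 + 1)) : ℤ) *
            Real.log p) +
          packetLogμ p (fun b => 𝔽.k (e b))
            (packetHull p (fun b => 𝔽.k (e b))
              (logPacket p (fun b => 𝔽.k (e b)) : Set (PacketAlgebra p (fun b => 𝔽.k (e b)))))) *
          ∏ b, weight F (e b).1 :=
  realPrimePacketWith_negLogThetaPerImageAt_eq_of_content p 𝔽 c hc0 hcσ t
    (fun i e => (v i e - 1) / (absRamificationIdx p (𝔽.k (e (Fin.last _))) : ℤ) + 1 - Fintype.card (Fin ((i : ℕ) + 1 + 1)))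
    fun i e => TameContent.content_iota_smul_normalizedPacket p (fun b => 𝔽.k (e b)) hp2 (fun b => he (e b)) (Fin.last _) (hv i e)

end RealPacketWith

/-! ## §4 Input level: the `p`-summand of `−|log(Θ)|^{(P)}` of a genuine Θ-volume input at a tame prime -/

namespace ThetaVolumeInput

variable {F₀ : Type} [Field F₀] [NumberField F₀] {K : Type} [Field K] [NumberField K] [Algebra F₀ K]
variable (I : ThetaVolumeInput F₀ K)

/-- **INPUT LEVEL** (Mochizuki's shell normalisation `packetAt`; GENUINE completions `K_{v̲} = RescaledCompletion K p v̲` of the section): at a prime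
`p > 2` over which every place `v̲` of the section is TAME, with `v(i,v⃗) ∈ ℤ` the last-slot valuations of `t_Θ`:
`negLogThetaPerImageLoc I p = (1/ℓ⋆)·Σ_i Σ_{v⃗} (−A(i,v⃗)·log p + log μ̄(hull(log_p(R_{v⃗}^×))))·Π_b Pr(v_b)`, `A(i,v⃗) = (v(i,v⃗) − 1) div e(v̲_j|p) + 1 − (j+1)`.
[cite: Mochizuki2012, IUTchIII Cor. 3.12 proof Step (x) p. 181] [cite: DupuyHilado2025, Def. 3.6.3, §4.12] [claim: Mochizuki2012, status: disputed] -/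
theorem negLogThetaPerImageLoc_eq_of_tame {p : ℕ} (hpp : p.Prime) (hp2 : 2 < p)
    (he : haveI : Fact p.Prime := ⟨hpp⟩; ∀ w : placesOver F₀ p, absRamificationIdx p ((I.σ.localFields p).k w) ≤ p - 2)
    (v : haveI : Fact p.Prime := ⟨hpp⟩; (i : Fin I.lstar) → (Fin ((i : ℕ) + 1 + 1) → placesOver F₀ p) → ℤ)
    (hv : haveI : Fact p.Prime := ⟨hpp⟩; ∀ (i : Fin I.lstar) (e : Fin ((i : ℕ) + 1 + 1) → placesOver F₀ p),
      ‖(I.tΘ p hpp i (e (Fin.last _)) : (I.σ.localFieldFamily p hpp).k (e (Fin.last _)))‖ =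
        (p : ℝ) ^ (-(v i e / (absRamificationIdx p ((I.σ.localFieldFamily p hpp).k (e (Fin.last _))) : ℝ)))) :
    haveI : Fact p.Prime := ⟨hpp⟩
    I.negLogThetaPerImageLoc p =
      (1 / (I.lstar : ℝ)) * ∑ i : Fin I.lstar, ∑ e : Fin ((i : ℕ) + 1 + 1) → placesOver F₀ p,
        (-(((v i e - 1) / (absRamificationIdx p ((I.σ.localFields p).k (e (Fin.last _))) : ℤ) + 1 -
              Fintype.card (Fin ((i : ℕ) + 1 + 1)) : ℤ) * Real.log p) +
          packetLogμ p (fun b => (I.σ.localFields p).k (e b))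
            (packetHull p (fun b => (I.σ.localFields p).k (e b))
              (logPacket p (fun b => (I.σ.localFields p).k (e b)) :
                Set (PacketAlgebra p (fun b => (I.σ.localFields p).k (e b)))))) *
          ∏ b, weight F₀ (e b).1 := by
  haveI : Fact p.Prime := ⟨hpp⟩
  rw [negLogThetaPerImageLoc_of_prime I hpp]
  exact realPrimePacketWith_negLogThetaPerImageAt_eq_of_tame p (I.σ.localFields p) (mScale p (I.σ.localFields p))
    (mScale_ne_zero p (I.σ.localFields p)) (mScale_perm p (I.σ.localFields p)) hp2 (I.tΘ p hpp) he v hv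

end ThetaVolumeInput

end Literature.IUT.LogVolume

end
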